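import Literature.NumberTheory.QuadraticForms.GlobalSquareTheorem
import Literature.NumberTheory.QuadraticForms.QuadraticNormIndex
import Literature.NumberTheory.Automorphic.AdicCompletionCompact
import Mathlib.RingTheory.DedekindDomain.FiniteAdeleRing
import HarnessLib

/-!
# A local norm at every finite place is a norm from the finite adèles: `x² − d y² = t` with `x, y ∈ 𝔸_{K,f}`

Topic `NumberTheory/QuadraticForms`; namespace `Literature.NumberTheory.QuadraticForms`.  THEOREMS ONLY (no definition, no
named fact, no instance, no `sorry`).  Cell `hodgecm-mathlib`, FLOOR-0 P4, input (LT-1) of the line transport `StubT3aLineTransportAt`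
(A-p17 (g12) `LT-census` 34b2b5ca §3; road (G) step (G2) needs a FINITE IDÈLE `z` of `E = K(√d)` with `N_{E/K} z = a′/a`): nothing here
mentions a hermitian line or a Weil representation.

SETTING ([Omeara1963] §63C, §65A).  `K` a number field, `v` a finite place, `K_v = v.adicCompletion K` with valuation ring `𝒪_v`,
`d ∈ K^×`, `E_v = K_v[√d]`, local norm group `N(E_v^×) = {x² − d y²} = quadraticNormSubgroup K_v d` (★ `QuadraticNormIndex`).

* §1 **`exists_integral_sq_sub_mul_sq_eq_of_valued_eq_one`** — at a place `v` with `|2|_v = |d|_v = |u|_v = 1` the equation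
  `x² − d y² = u` has a solution with `x, y ∈ 𝒪_v` (INTEGRAL, not merely in `K_v` as in ★
  `exists_sq_sub_mul_sq_eq_of_valued_eq_one_of_isUnramifiedIn`): solve it in the (finite, odd) residue field (Mathlib
  `FiniteField.exists_root_sum_quadratic`), lift, and absorb the defect `≡ 1 (mod 𝔪_v)` into a square (★ `isSquare_of_valued_sub_one_lt`).
  This is O'Meara's «`N 𝔘_E = 𝔲_F` at an unramified non-dyadic place» in soluble form.
* §2 **`exists_finiteAdele_sq_sub_mul_sq_eq`** — if `t ∈ K^×` is a local norm from `K_v[√d]` at EVERY finite place `v`, then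
  `x² − d y² = t` is soluble in the finite adèle ring `𝔸_{K,f}` (componentwise solutions, integral at the cofinitely many places of §1:
  O'Meara's «an idèle is in `N_{E/F} J_E` iff it is a local norm at all `𝔭`», finite part, for the principal idèle `t`); equivalently
  `z := x + y√d` is a unit of `𝔸_{E,f} = 𝔸_{K,f}[√d]` with `N z = t`.  **`exists_finiteAdele_sq_sub_mul_sq_eq_of_forall_mk_eq`** — the
  same from the equality of the local norm CLASSES of `a, a′ ∈ K^×` at every finite place (`t = a⁻¹ a′`; the hypothesis
  `locF K d a = locF K d a′` of [Liu2021, Def. 4.12] unfolds to it by `funext`).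

HC_CM is proved only modulo the 7 printed citations until rung 0 closes; this file proves nothing about them.

## References
* [Omeara1963] O. T. O'Meara, *Introduction to quadratic forms*, Grundlehren 117, Springer (1963), §63C Example 63:16 (units are norms of
  units at an unramified place), §65A Example 65:2 (`𝔦 ∈ N_{E/F} J_E` iff `𝔦` is a local norm at all `𝔭`).
-/

set_option autoImplicit false

noncomputable section

open NumberField IsDedekindDomain Valued Polynomial

namespace Literature.NumberTheory.QuadraticForms

variable (K : Type) [Field K] [NumberField K] (v : HeightOneSpectrum (𝓞 K))

/-! ## §1 Units are norms of local INTEGERS at the places `v ∤ 2 d u` -/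

/-- **Units are norms of units, integral form.**  At a finite place `v` of `K` with `|2|_v = 1`, for `θ, u ∈ K_v` with
`|θ|_v = |u|_v = 1`, there are `x, y ∈ 𝒪_v` (`|x|_v, |y|_v ≤ 1`) with `x² − θ y² = u`: the residue field `k_v` is finite of odd
cardinality, so `X² − θ̄ Y² = ū` is soluble in `k_v` (Mathlib `FiniteField.exists_root_sum_quadratic`); for lifts `x₀, y₀ ∈ 𝒪_v` the unit
`w = x₀² − θ y₀²` satisfies `|w/u − 1|_v < 1 = |4|_v`, so `w/u = r²` with `|r|_v = 1` (★ `isSquare_of_valued_sub_one_lt`), and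
`(x₀/r)² − θ (y₀/r)² = u`. [cite: Omeara1963, §63C Example 63:16] -/
theorem exists_integral_sq_sub_mul_sq_eq_of_valued_eq_one {θ u : v.adicCompletion K}
    (h2 : Valued.v (2 : v.adicCompletion K) = 1) (hθ : Valued.v θ = 1) (hu : Valued.v u = 1) :
    ∃ x y : v.adicCompletion K, Valued.v x ≤ 1 ∧ Valued.v y ≤ 1 ∧ x ^ 2 - θ * y ^ 2 = u := by
  haveI : Finite 𝓀[v.adicCompletion K] := Literature.NumberTheory.Automorphic.finite_residueField_adicCompletion K v
  letI : Fintype 𝓀[v.adicCompletion K] := Fintype.ofFinite _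
  set Θ : 𝒪[v.adicCompletion K] := ⟨θ, hθ.le⟩ with hΘ
  set U : 𝒪[v.adicCompletion K] := ⟨u, hu.le⟩ with hU
  -- the residue field has odd cardinality
  have h2max : (2 : 𝒪[v.adicCompletion K]) ∉ IsLocalRing.maximalIdeal 𝒪[v.adicCompletion K] := by
    rw [mem_maximalIdeal_integer_iff K v]
    show ¬ Valued.v (2 : v.adicCompletion K) < 1
    rw [h2]; exact lt_irrefl 1
  have h2k : (2 : 𝓀[v.adicCompletion K]) ≠ 0 := by
    intro h0
    apply h2max
    rw [← IsLocalRing.residue_eq_zero_iff]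
    rw [map_ofNat]; exact h0
  have hcard : Fintype.card 𝓀[v.adicCompletion K] % 2 = 1 := by
    by_contra hc
    have hc0 : Fintype.card 𝓀[v.adicCompletion K] % 2 = 0 := by omega
    have hchar := (FiniteField.even_card_iff_char_two).2 hc0
    apply h2k
    have := ringChar.Nat.cast_ringChar (R := 𝓀[v.adicCompletion K])
    rw [hchar] at this
    exact_mod_cast this
  -- the residues of `θ`, `u`
  have hΘk : IsLocalRing.residue 𝒪[v.adicCompletion K] Θ ≠ 0 := by
    rw [Ne, IsLocalRing.residue_eq_zero_iff, mem_maximalIdeal_integer_iff K v]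
    show ¬ Valued.v θ < 1
    rw [hθ]; exact lt_irrefl 1
  -- solve `a² - Θ̄ b² = Ū` in the residue field
  obtain ⟨a, b, hab⟩ := FiniteField.exists_root_sum_quadratic
    (f := X ^ 2 - C (IsLocalRing.residue 𝒪[v.adicCompletion K] U))
    (g := C (- IsLocalRing.residue 𝒪[v.adicCompletion K] Θ) * X ^ 2)
    (degree_X_pow_sub_C (by norm_num) _) (by rw [degree_C_mul_X_pow 2 (neg_ne_zero.2 hΘk)]; rfl) hcard
  simp only [eval_sub, eval_pow, eval_X, eval_C, eval_mul] at hab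
  -- lift
  obtain ⟨x₀, hx₀⟩ : ∃ x₀, IsLocalRing.residue 𝒪[v.adicCompletion K] x₀ = a :=
    Ideal.Quotient.mk_surjective (I := IsLocalRing.maximalIdeal 𝒪[v.adicCompletion K]) a
  obtain ⟨y₀, hy₀⟩ : ∃ y₀, IsLocalRing.residue 𝒪[v.adicCompletion K] y₀ = b :=
    Ideal.Quotient.mk_surjective (I := IsLocalRing.maximalIdeal 𝒪[v.adicCompletion K]) b
  have hres : IsLocalRing.residue 𝒪[v.adicCompletion K] (x₀ ^ 2 - Θ * y₀ ^ 2 - U) = 0 := by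
    simp only [map_sub, map_mul, map_pow, hx₀, hy₀]
    linear_combination hab
  rw [IsLocalRing.residue_eq_zero_iff, mem_maximalIdeal_integer_iff K v] at hres
  -- in `K_v`
  have hW : Valued.v ((x₀ : v.adicCompletion K) ^ 2 - θ * (y₀ : v.adicCompletion K) ^ 2 - u) < 1 := by
    simpa using hres
  set W : v.adicCompletion K := (x₀ : v.adicCompletion K) ^ 2 - θ * (y₀ : v.adicCompletion K) ^ 2 with hWdef
  have hu0 : u ≠ 0 := fun h0 => by rw [h0, map_zero] at hu; exact zero_ne_one hu
  have hWv : Valued.v W = 1 := by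
    rw [← hu]
    exact Valuation.map_eq_of_sub_lt _ (by rw [hu]; exact hW)
  have hW0 : W ≠ 0 := fun h0 => by rw [h0, map_zero] at hWv; exact zero_ne_one hWv
  -- `W / u` is a square `r²` with `r` a unit
  have h4 : Valued.v (4 : v.adicCompletion K) = 1 := by
    have : (4 : v.adicCompletion K) = 2 * 2 := by norm_num
    rw [this, map_mul, h2, one_mul]
  have hsq : IsSquare (W / u) := by
    refine isSquare_of_valued_sub_one_lt K v ?_
    rw [h4]
    have : W / u - 1 = (W - u) / u := by field_simp
    rw [this, map_div₀, hu, div_one]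
    exact hW
  obtain ⟨r, hr⟩ := hsq
  have hrv : Valued.v r = 1 := by
    have h1 : Valued.v r * Valued.v r = 1 := by
      rw [← map_mul, ← hr, map_div₀, hWv, hu, div_one]
    have h1' : Valued.v r ^ 2 = 1 := by rw [sq]; exact h1
    exact (pow_eq_one_iff.1 h1').resolve_right two_ne_zero
  have hr0 : r ≠ 0 := fun h0 => by rw [h0, map_zero] at hrv; exact zero_ne_one hrv
  refine ⟨(x₀ : v.adicCompletion K) / r, (y₀ : v.adicCompletion K) / r, ?_, ?_, ?_⟩
  · rw [map_div₀, hrv, div_one]; exact x₀.2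
  · rw [map_div₀, hrv, div_one]; exact y₀.2
  · have e : ((x₀ : v.adicCompletion K) / r) ^ 2 - θ * ((y₀ : v.adicCompletion K) / r) ^ 2 = W / (r * r) := by
      rw [hWdef]; field_simp
    rw [e, ← hr]
    field_simp

/-! ## §2 A local norm at every finite place is a norm from the finite adèles -/

variable {K} in
/-- **`x² − d y² = t` is soluble in `𝔸_{K,f}` as soon as it is soluble in every `K_v`** (`d ≠ 0`, `t ∈ K^×`): choose local solutions
everywhere, INTEGRAL ones (§1) at the cofinitely many places where `2, d, t` are units (a non-zero element of `K` is a unit at almost all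
places — Mathlib `FiniteAdeleRing.isUnit_iff` on the principal adèle), and assemble them in the restricted product.  Equivalently
`z = x + y√d ∈ 𝔸_{E,f}^×`, `E = K(√d)`, has `N_{E/K} z = t`: the finite part of «`𝔦 ∈ N_{E/F} J_E` iff `𝔦` is a local norm at every `𝔭`»
for the principal idèle `t`. [cite: Omeara1963, §65A Example 65:2] -/
theorem exists_finiteAdele_sq_sub_mul_sq_eq {d : K} (hd : d ≠ 0) (t : Kˣ)
    (h : ∀ v : HeightOneSpectrum (𝓞 K),
      Units.map (algebraMap K (v.adicCompletion K)).toMonoidHom t ∈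
        quadraticNormSubgroup (v.adicCompletion K) (algebraMap K (v.adicCompletion K) d)) :
    ∃ x y : FiniteAdeleRing (𝓞 K) K,
      x ^ 2 - algebraMap K (FiniteAdeleRing (𝓞 K) K) d * y ^ 2 = algebraMap K (FiniteAdeleRing (𝓞 K) K) (t : K) := by
  classical
  -- a non-zero element of `K` is a unit at almost all places
  have hev : ∀ c : K, c ≠ 0 →
      ∀ᶠ v : HeightOneSpectrum (𝓞 K) in Filter.cofinite, Valued.v (algebraMap K (v.adicCompletion K) c) = 1 := by
    intro c hc
    have hunit : IsUnit (algebraMap K (FiniteAdeleRing (𝓞 K) K) c) := (isUnit_iff_ne_zero.2 hc).map _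
    filter_upwards [(FiniteAdeleRing.isUnit_iff.1 hunit).2] with v hv
    exact hv
  have hgood : ∀ᶠ v : HeightOneSpectrum (𝓞 K) in Filter.cofinite,
      Valued.v (2 : v.adicCompletion K) = 1 ∧ Valued.v (algebraMap K (v.adicCompletion K) d) = 1 ∧
        Valued.v (algebraMap K (v.adicCompletion K) (t : K)) = 1 := by
    filter_upwards [hev 2 two_ne_zero, hev d hd, hev (t : K) t.ne_zero] with v h2 hdv htv
    exact ⟨by rw [map_ofNat] at h2; exact h2, hdv, htv⟩
  -- local solutions everywhere, integral ones at the good places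
  have hloc : ∀ v : HeightOneSpectrum (𝓞 K), ∃ xy : v.adicCompletion K × v.adicCompletion K,
      xy.1 ^ 2 - algebraMap K (v.adicCompletion K) d * xy.2 ^ 2 = algebraMap K (v.adicCompletion K) (t : K) := by
    intro v
    obtain ⟨x, y, hxy⟩ := (mem_quadraticNormSubgroup_iff).1 (h v)
    exact ⟨(x, y), by rw [hxy]; rfl⟩
  have hint : ∀ v : HeightOneSpectrum (𝓞 K),
      (Valued.v (2 : v.adicCompletion K) = 1 ∧ Valued.v (algebraMap K (v.adicCompletion K) d) = 1 ∧
        Valued.v (algebraMap K (v.adicCompletion K) (t : K)) = 1) →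
      ∃ xy : v.adicCompletion K × v.adicCompletion K, Valued.v xy.1 ≤ 1 ∧ Valued.v xy.2 ≤ 1 ∧
        xy.1 ^ 2 - algebraMap K (v.adicCompletion K) d * xy.2 ^ 2 = algebraMap K (v.adicCompletion K) (t : K) := by
    rintro v ⟨h2, hdv, htv⟩
    obtain ⟨x, y, hx, hy, hxy⟩ := exists_integral_sq_sub_mul_sq_eq_of_valued_eq_one K v h2 hdv htv
    exact ⟨(x, y), hx, hy, hxy⟩
  let X : ∀ v : HeightOneSpectrum (𝓞 K), v.adicCompletion K × v.adicCompletion K := fun v =>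
    if hv : (Valued.v (2 : v.adicCompletion K) = 1 ∧ Valued.v (algebraMap K (v.adicCompletion K) d) = 1 ∧
        Valued.v (algebraMap K (v.adicCompletion K) (t : K)) = 1) then (hint v hv).choose else (hloc v).choose
  have hX : ∀ v, (X v).1 ^ 2 - algebraMap K (v.adicCompletion K) d * (X v).2 ^ 2 =
      algebraMap K (v.adicCompletion K) (t : K) := by
    intro v
    by_cases hv : (Valued.v (2 : v.adicCompletion K) = 1 ∧ Valued.v (algebraMap K (v.adicCompletion K) d) = 1 ∧
        Valued.v (algebraMap K (v.adicCompletion K) (t : K)) = 1)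
    · simp only [X, dif_pos hv]; exact (hint v hv).choose_spec.2.2
    · simp only [X, dif_neg hv]; exact (hloc v).choose_spec
  have hXint : ∀ᶠ v : HeightOneSpectrum (𝓞 K) in Filter.cofinite,
      Valued.v (X v).1 ≤ 1 ∧ Valued.v (X v).2 ≤ 1 := by
    filter_upwards [hgood] with v hv
    simp only [X, dif_pos hv]
    exact ⟨(hint v hv).choose_spec.1, (hint v hv).choose_spec.2.1⟩
  refine ⟨⟨fun v => (X v).1, ?_⟩, ⟨fun v => (X v).2, ?_⟩, ?_⟩
  · filter_upwards [hXint] with v hv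
    exact (HeightOneSpectrum.mem_adicCompletionIntegers (𝓞 K) K v).2 hv.1
  · filter_upwards [hXint] with v hv
    exact (HeightOneSpectrum.mem_adicCompletionIntegers (𝓞 K) K v).2 hv.2
  · refine FiniteAdeleRing.ext K fun v => ?_
    show (X v).1 ^ 2 - algebraMap K (v.adicCompletion K) d * (X v).2 ^ 2 = algebraMap K (v.adicCompletion K) (t : K)
    exact hX v

variable {K} in
/-- **The same from equal local norm CLASSES**: if `a, a′ ∈ K^×` have the same class in `K_v^× ⧸ N(K_v[√d]^×)` at every finite place
`v` (for `d = δ²` the CM datum this is the hypothesis `locF K d a = locF K d a′` of [Liu2021, Def. 4.12], read componentwise), then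
`x² − d y² = a⁻¹ a′` is soluble in `𝔸_{K,f}` — a finite idèle `z = x + y√d` of `K(√d)` with `N z · a = a′`.
[cite: Omeara1963, §65A Example 65:2] -/
theorem exists_finiteAdele_sq_sub_mul_sq_eq_of_forall_mk_eq {d : K} (hd : d ≠ 0) (a a' : Kˣ)
    (h : ∀ v : HeightOneSpectrum (𝓞 K),
      (Units.map (algebraMap K (v.adicCompletion K)).toMonoidHom a :
          (v.adicCompletion K)ˣ ⧸ quadraticNormSubgroup (v.adicCompletion K) (algebraMap K (v.adicCompletion K) d)) =
        (Units.map (algebraMap K (v.adicCompletion K)).toMonoidHom a' :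
          (v.adicCompletion K)ˣ ⧸ quadraticNormSubgroup (v.adicCompletion K) (algebraMap K (v.adicCompletion K) d))) :
    ∃ x y : FiniteAdeleRing (𝓞 K) K,
      x ^ 2 - algebraMap K (FiniteAdeleRing (𝓞 K) K) d * y ^ 2 =
        algebraMap K (FiniteAdeleRing (𝓞 K) K) ((a⁻¹ * a' : Kˣ) : K) :=
  exists_finiteAdele_sq_sub_mul_sq_eq hd (a⁻¹ * a') fun v => by
    rw [map_mul, map_inv]
    exact QuotientGroup.eq.1 (h v)

end Literature.NumberTheory.QuadraticForms

end
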